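import Literature.Computability.Complexity.NTIMEPadding
import Literature.Computability.Complexity.NTIMEVerifierNormal
import Literature.Computability.Complexity.ClockedUniversalAcceptanceProofs
import Literature.Computability.Complexity.NPBoundedQuantifiers
import Literature.Computability.Complexity.ExpClosure
import Literature.Computability.Complexity.NSubexp
import Literature.Computability.Complexity.FoldBricks
import Literature.Computability.Complexity.UnaryBricks
import Literature.Computability.Complexity.PRelHierarchy
import HarnessLib

/-!
# `NEXP` by polynomial-time matrices with exponentially long certificates; closure properties

Literature / complexity toolkit (serves Chen–Jin–Santhanam–Williams 2022, Thm. 1.2 for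
`𝒟 = NEXP`, `MetaComplexity/ConstructiveSeparations.lean`, whose proof needs `NEXP` closed under
polynomially bounded `∃`/`∀`, under `∩`, `∪` and under Karp reductions). The tree's
`NEXP = ⋃ₖ NTIME(2^{nᵏ})` (`Nondeterministic.lean`) is in the one-constant verifier form, with a raw
machine specified only on admissible witnesses; this file proves once and for all the textbook
presentation

  `L ∈ NEXP ↔ ∃ R ∈ P, ∃ k c, (x ∈ L → ∃ y, |y| ≤ c·2^{|x|ᵏ} + c ∧ ⟨x, y⟩ ∈ R) ∧ (⟨x, y⟩ ∈ R → x ∈ L)`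

("`NEXP` is the class of languages with exponentially long, polynomial-time checkable
certificates", Arora–Barak 2009, §2.6.2 with Def. 2.1; Papadimitriou 1994, §20.1), after which every
closure property is a manipulation of `P` languages by the brick algebra:

* `mem_NEXP_of_certificates` (into `NEXP`): the verifier is the truncating wrapper `truncMapAux`
  (`TruncMapMachine.lean`) of the exponential clock `expClock` (`NTIMEPadding.lean`) followed by the
  polynomial-time decider of `R` — the template of `NP_subset_NTIME_two_pow`;
* `exists_certificates_of_mem_NEXP` (out of `NEXP`): normalise the verifier to a total one
  (`exists_normalVerifier`), pad the witness (`⟨y, 1^{2ⁿ}⟩`) so that its exponential running time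
  is polynomial in the length of the pair, and read acceptance off the clocked universal machine
  `clockedUniversalAcceptance_holds` (`U ∈ P` with completeness AND soundness); the level `k` is
  first brought to `NTIME(2ⁿ)` by `padPre_mem_NTIME_two_pow`;
* consequences: `preimage_mem_NEXP_of_mem_FP`, `mem_NEXP_of_karpReducible`, `P_subset_NEXP`,
  `inter_mem_NEXP`, `union_mem_NEXP`, `polyExists_NEXP_subset_NEXP`, `polyForall_NEXP_subset_NEXP`
  ("concatenate the witnesses for every possibility in the universal quantifier",
  Chen–Jin–Santhanam–Williams 2022, proof of Cor. 5.3).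

All proved; no named fact.

## References

* S. Arora, B. Barak, *Computational Complexity: A Modern Approach*, CUP 2009, Def. 2.1, §2.1
  (Claim 2.4, Exercise 2.10), §2.6.2 (`NEXP`), Thm. 1.9 / §1.4.1 (clocked universal machine)
  [AroraBarak2009].
* C. H. Papadimitriou, *Computational Complexity*, Addison-Wesley 1994, §20.1 [Papadimitriou1994].
* L. Chen, C. Jin, R. Santhanam, R. Williams, *Constructive separations and their consequences*,
  FOCS 2021 / TheoretiCS 3 (2024), §5.1 (proof of Cor. 5.3: `(∀ poly) NEXP ⊆ NEXP`) [ChenEtAl2022].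
-/

namespace Literature.Computability.Complexity

open _root_.Computability Turing Polynomial Brick Plumb
open scoped Notation

namespace NEXPCert

/-! ### Arithmetic -/

/-- `2^{d·nᵏ} ≤ 2^{n^{k+1}} + 2^{d·dᵏ}` (split on `d ≤ n`). [folklore] -/
theorem two_pow_mul_pow_le (d n k : ℕ) : 2 ^ (d * n ^ k) ≤ 2 ^ (n ^ (k + 1)) + 2 ^ (d * d ^ k) := by
  rcases le_or_gt d n with h | h
  · have : d * n ^ k ≤ n ^ (k + 1) := by
      rw [pow_succ']
      exact Nat.mul_le_mul_right _ h
    exact le_add_right (Nat.pow_le_pow_right Nat.two_pos this)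
  · have : d * n ^ k ≤ d * d ^ k := Nat.mul_le_mul_left _ (Nat.pow_le_pow_left h.le k)
    exact le_add_left (Nat.pow_le_pow_right Nat.two_pos this)

/-- Every polynomial exponent is dominated by one power: `2^{Q(n)} ≤ b · 2^{n^K}` with `K ≥ 1`.
[folklore] -/
theorem exists_two_pow_eval_le (Q : Polynomial ℕ) :
    ∃ K b : ℕ, 1 ≤ K ∧ ∀ n, 2 ^ Q.eval n ≤ b * 2 ^ (n ^ K) := by
  obtain ⟨d, C, h⟩ := exists_eval_le_pow_add Q
  refine ⟨d + 1, 2 ^ (C + 1), by omega, fun n => ?_⟩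
  have h1 : n ^ d ≤ n ^ (d + 1) + 1 := by
    rcases Nat.eq_zero_or_pos n with rfl | hn
    · cases d <;> simp
    · exact le_add_right (Nat.pow_le_pow_right hn (Nat.le_succ d))
  calc 2 ^ Q.eval n ≤ 2 ^ (n ^ (d + 1) + (C + 1)) := Nat.pow_le_pow_right Nat.two_pos (by have := h n; omega)
    _ = 2 ^ (C + 1) * 2 ^ (n ^ (d + 1)) := by rw [pow_add, mul_comm]

/-- `c · 2^{nᵏ} + c ≤ 2c · 2^{n^{k+1}} + 2c`. [folklore] -/
theorem witness_bound_le_succ (c n k : ℕ) :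
    c * 2 ^ (n ^ k) + c ≤ 2 * c * 2 ^ (n ^ (k + 1)) + 2 * c := by
  rcases Nat.eq_zero_or_pos n with rfl | hn
  · have h1 : 2 ^ (0 ^ k) ≤ 2 := by cases k <;> simp
    have h2 : (0 : ℕ) ^ (k + 1) = 0 := by simp
    rw [h2, pow_zero, mul_one]
    nlinarith
  · have h1 : 2 ^ (n ^ k) ≤ 2 ^ (n ^ (k + 1)) :=
      Nat.pow_le_pow_right Nat.two_pos (Nat.pow_le_pow_right hn (Nat.le_succ k))
    have h2 := Nat.mul_le_mul_left c h1
    rw [mul_assoc]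
    omega

/-! ### Membership in lattice combinations of languages (syntactic rewriting lemmas) -/

/-- `w ∈ A ⊓ B ↔ w ∈ A ∧ w ∈ B`. [folklore] -/
theorem mem_inf_iff {A B : Language Bool} {w : List Bool} : w ∈ A ⊓ B ↔ w ∈ A ∧ w ∈ B := Iff.rfl

/-- `w ∈ A ⊔ B ↔ w ∈ A ∨ w ∈ B`. [folklore] -/
theorem mem_sup_iff {A B : Language Bool} {w : List Bool} : w ∈ A ⊔ B ↔ w ∈ A ∨ w ∈ B := Iff.rfl

/-- `w ∈ Aᶜ ↔ w ∉ A`. [folklore] -/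
theorem mem_compl_iff {A : Language Bool} {w : List Bool} : w ∈ Aᶜ ↔ w ∉ A := Iff.rfl

/-- The preimage of a language under a string map, typed as a language (so that membership in
lattice combinations rewrites syntactically). [folklore] -/
def preimageL (f : List Bool → List Bool) (A : Language Bool) : Language Bool := f ⁻¹' A

/-- `w ∈ preimageL f A ↔ f w ∈ A`. [folklore] -/
theorem mem_preimageL {f : List Bool → List Bool} {A : Language Bool} {w : List Bool} :
    w ∈ preimageL f A ↔ f w ∈ A := Iff.rfl

/-- `preimageL f A ∈ P` for `A ∈ P`, `f ∈ FP` (`preimage_mem_P`). [folklore] -/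
theorem preimageL_mem_P {f : List Bool → List Bool} {A : Language Bool} (hA : A ∈ Classes.P) (hf : f ∈ FP) :
    preimageL f A ∈ Classes.P := preimage_mem_P hA hf

end NEXPCert

open NEXPCert

/-! ### Into `NEXP` -/

/-- **Polynomial-time matrices with exponentially bounded witnesses define `NEXP` languages**
(Arora–Barak 2009, §2.6.2 with Def. 2.1: "`NEXP` … certificates of exponential length checkable
in polynomial time in the certificate length"). If `R ∈ P` and every `x ∈ L` has a witness `y`
with `|y| ≤ c·2^{|x|ᵏ} + c` and `⟨x, y⟩ ∈ R`, while `⟨x, y⟩ ∈ R` always forces `x ∈ L`, then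
`L ∈ NEXP`: the verifier cuts the witness at length `2c·2^{|x|^{k+1}} + 2c` by the truncating
wrapper of the exponential clock (`truncMapAux`, `expClock`) and runs the decider of `R`; all
bounds are `O(2^{|x|^{k+2}}) + |y|/2`. [cite: AroraBarak2009, §2.6.2] -/
theorem mem_NEXP_of_certificates {L R : Language Bool} (hR : R ∈ Classes.P) (k c : ℕ)
    (hcomp : ∀ x ∈ L, ∃ y : List Bool, y.length ≤ c * 2 ^ (x.length ^ k) + c ∧ boolPair x y ∈ R)
    (hsound : ∀ x y : List Bool, boolPair x y ∈ R → x ∈ L) : L ∈ NEXP := by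
  -- a decider of `R`
  have hR' := hR
  simp only [Classes.P, Set.mem_iUnion] at hR'
  obtain ⟨j, a, hdec⟩ := hR'
  obtain ⟨M, hM⟩ := (hdec : TimeDecidable id R fun n => a * n ^ j + a)
  -- the clock `x ↦ ⟨x, 1^{W |x|}⟩`, `W n = 2c · 2^{n^{k+1}} + 2c`
  obtain ⟨C, Ck, hCk⟩ := exists_timeComputable_expClock (2 * c) (k := k + 1) (by omega)
  let V : TM2ComputableAux Bool Bool := (truncMapAux Ck).comp M
  let W : ℕ → ℕ := fun n => 2 * c * 2 ^ (n ^ (k + 1)) + 2 * c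
  -- constants
  let D₁ : ℕ := C + 5 + 4 * (2 * c)
  let D₂ : ℕ := a * (4 * (2 * c) + 4) ^ j
  let G : ℕ := 2 ^ (j * j ^ (k + 1))
  let B : ℕ := D₁ + D₂ + (2 * D₁ + C + 4 * (2 * c) + 11 + D₂ * G + a) + 1
  simp only [NEXP, Set.mem_iUnion]
  refine ⟨k + 1 + 1, 2 * B + 2, fun x y => R.boolIndicator (boolPair x (y.take (W x.length))), V,
    fun x y hy => ?_, fun x => ?_⟩
  · -- running time
    set n := x.length with hn
    set E : ℕ := 2 ^ (n ^ (k + 1)) with hE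
    set F : ℕ := 2 ^ (n ^ (k + 1 + 1)) with hF
    have hclock : Ck.OutputsWithin x (expClock (2 * c) (k + 1) x) (C * 2 ^ (n ^ (k + 1)) + C) := hCk x
    have h₁ := outputsWithin_truncMapAux_boolPair Ck (y := y) hclock
    simp only [List.length_replicate, ← hn] at h₁
    set y' := y.take (2 * c * 2 ^ (n ^ (k + 1)) + 2 * c) with hy'
    have hlen' : y'.length ≤ 2 * c * E + 2 * c := List.length_take_le _ _
    -- basic estimates
    have hE1 : 1 ≤ E := Nat.one_le_two_pow
    have hnE : n ≤ E := by
      have h1 : n ≤ n ^ (k + 1) := Nat.le_self_pow (by omega) n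
      exact (Nat.lt_two_pow_self).le.trans (Nat.pow_le_pow_right Nat.two_pos h1)
    have hEF : E ≤ F + 2 := by
      have := two_pow_mul_pow_le 1 n (k + 1)
      simpa using this
    have hQ : E ^ j ≤ F + G := by
      have := two_pow_mul_pow_le j n (k + 1)
      rw [hE, ← pow_mul, mul_comm]
      exact this
    have hbase : 2 * n + 2 + y'.length ≤ (4 * (2 * c) + 4) * E := by nlinarith
    have hpow : (2 * n + 2 + y'.length) ^ j ≤ (4 * (2 * c) + 4) ^ j * E ^ j := by
      rw [← mul_pow]
      exact Nat.pow_le_pow_left hbase j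
    have h₂ : M.OutputsWithin (boolPair x y') (encodeBool (R.boolIndicator (boolPair x y')))
        (D₂ * (F + G) + a) := by
      refine (hM (boolPair x y')).mono ?_
      simp only [id, length_boolPair, ← hn]
      have : a * (2 * n + 2 + y'.length) ^ j ≤ D₂ * (F + G) := by
        calc a * (2 * n + 2 + y'.length) ^ j ≤ a * ((4 * (2 * c) + 4) ^ j * E ^ j) :=
              Nat.mul_le_mul_left a hpow
          _ = D₂ * E ^ j := by simp only [D₂]; ring
          _ ≤ D₂ * (F + G) := Nat.mul_le_mul_left _ hQ
      omega
    have h := Turing.TM2ComputableAux.comp_outputsWithin _ _ h₁ h₂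
    refine h.mono ?_
    have hy2 : 2 * (y.length / 2) ≤ (2 * B + 2) * F + (2 * B + 2) :=
      (Nat.mul_div_le y.length 2).trans hy
    have hCE : C * E ≤ C * F + 2 * C := by nlinarith [hEF]
    have hcE : 2 * c * E ≤ 2 * c * F + 2 * (2 * c) := by nlinarith [hEF]
    have hD : D₂ * (F + G) = D₂ * F + D₂ * G := by ring
    have hB : D₁ + D₂ + (2 * D₁ + C + 4 * (2 * c) + 11 + D₂ * G + a) + 1 = B := rfl
    have hD₁ : C + 5 + 4 * (2 * c) = D₁ := rfl
    -- everything is linear now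
    nlinarith [hy2, hCE, hcE, hD, hnE, hEF, hB, hD₁, Nat.zero_le (D₁ * F), Nat.zero_le (D₂ * F),
      Nat.zero_le F]
  · -- correctness
    set n := x.length with hn
    have hcW : c * 2 ^ (n ^ k) + c ≤ W n := witness_bound_le_succ c n k
    have hWB : W n ≤ (2 * B + 2) * 2 ^ (n ^ (k + 1 + 1)) + (2 * B + 2) := by
      have hEF : 2 ^ (n ^ (k + 1)) ≤ 2 ^ (n ^ (k + 1 + 1)) + 2 := by
        have := two_pow_mul_pow_le 1 n (k + 1)
        simpa using this
      have hB : 4 * (2 * c) ≤ B := by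
        simp only [B, D₁]
        omega
      have h1 := Nat.mul_le_mul_left (2 * c) hEF
      have h2 : 2 * c * 2 ^ (n ^ (k + 1 + 1)) ≤ B * 2 ^ (n ^ (k + 1 + 1)) :=
        Nat.mul_le_mul_right _ (by omega)
      have h3 : B * 2 ^ (n ^ (k + 1 + 1)) ≤ (2 * B + 2) * 2 ^ (n ^ (k + 1 + 1)) :=
        Nat.mul_le_mul_right _ (by omega)
      calc W n = 2 * c * 2 ^ (n ^ (k + 1)) + 2 * c := rfl
        _ ≤ 2 * c * (2 ^ (n ^ (k + 1 + 1)) + 2) + 2 * c := Nat.add_le_add_right h1 _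
        _ = 2 * c * 2 ^ (n ^ (k + 1 + 1)) + 6 * c := by ring
        _ ≤ (2 * B + 2) * 2 ^ (n ^ (k + 1 + 1)) + (2 * B + 2) :=
            Nat.add_le_add (h2.trans h3) (by omega)
    constructor
    · intro hx
      obtain ⟨y, hy, hyR⟩ := hcomp x hx
      refine ⟨y, hy.trans (hcW.trans hWB), ?_⟩
      show R.boolIndicator (boolPair x (y.take (W n))) = true
      rw [List.take_of_length_le (hy.trans hcW)]
      exact (Set.mem_iff_boolIndicator _ _).1 hyR
    · rintro ⟨y, -, hy⟩
      exact hsound x _ ((Set.mem_iff_boolIndicator _ _).2 hy)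

/-! ### Out of `NEXP` -/

/-- **Certificates for `NTIME(2ⁿ)`**: for `L ∈ NTIME(2ⁿ)` there are `R ∈ P` and `c` such that
every `x ∈ L` has a witness of length `≤ c·2^{|x|} + c` in `R`, and `⟨x, y⟩ ∈ R` forces `x ∈ L`
for every `y`. The matrix `R` reads acceptance of the total (normal-form) verifier of `L`, applied
to `⟨x, first component of y⟩`, off the clocked universal machine of
`clockedUniversalAcceptance_holds`, with budget polynomial in the length of the pair; honest
witnesses carry a pad `1^{2ⁿ}` that makes the verifier's time `a(2ⁿ + |y|) + a` polynomial in
that length. [cite: AroraBarak2009, §2.6.2] -/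
theorem exists_certificates_of_mem_NTIME_two_pow {L : Language Bool}
    (hL : L ∈ NTIME (fun n => 2 ^ n)) :
    ∃ R ∈ Classes.P, ∃ c : ℕ,
      (∀ x ∈ L, ∃ y : List Bool, y.length ≤ c * 2 ^ x.length + c ∧ boolPair x y ∈ R) ∧
      (∀ x y : List Bool, boolPair x y ∈ R → x ∈ L) := by
  obtain ⟨c, R₀, M, hM, hLR⟩ := hL
  obtain ⟨R', M', a, hM', hL', hshort⟩ :=
    exists_normalVerifier TimeConstructible.isTimeConstructible_two_pow hM hLR
  -- the projection `⟨x, ⟨y, pad⟩⟩ ↦ ⟨x, y⟩` followed by the total verifier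
  have hproj : fanoutFn fstF (fstF ∘ sndF) ∈ FP :=
    fanoutFn_mem_FP fstF_mem_FP (comp_mem_FP fstF_mem_FP sndF_mem_FP)
  obtain ⟨ph, H, hH⟩ := hproj
  let V₂ : TM2ComputableAux Bool Bool := H.comp M'
  have hV₂ : ∀ z : List Bool, V₂.OutputsWithin z (encodeBool (R' (fstF z) (fstF (sndF z))))
      (a * (2 ^ (fstF z).length + (fstF (sndF z)).length) + a + ph.eval z.length) := fun z => by
    have h1 : H.OutputsWithin z (boolPair (fstF z) (fstF (sndF z))) (ph.eval z.length) := by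
      have := hH z
      simpa [fanoutFn_apply] using this
    exact Turing.TM2ComputableAux.comp_outputsWithin _ _ h1 (hM' _ _)
  obtain ⟨U, hU, hUniv⟩ := clockedUniversalAcceptance_holds
  obtain ⟨e, p, hcomplete, hsnd⟩ := hUniv V₂
  let T : Polynomial ℕ := Polynomial.C a * (X + X) + Polynomial.C a + ph
  let q : Polynomial ℕ := p.comp T
  let g : List Bool → List Bool := fanoutFn (fun _ => e) (fanoutFn id (polyFn q))
  have hg_apply : ∀ z, g z = boolPair e (boolPair z (ones (q.eval z.length))) := fun z => by
    simp only [g]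
    rw [fanoutFn_apply, fanoutFn_apply, polyFn_apply]
    rfl
  refine ⟨(g ⁻¹' U : Language Bool), ?_, 2 * c + 2, ?_, ?_⟩
  · -- the matrix is in `P`
    exact preimage_mem_P hU
      (fanoutFn_mem_FP (const_mem_FP e) (fanoutFn_mem_FP OracleCompose.id_mem_FP (polyFn_mem_FP q)))
  · -- completeness: pad the shortened witness
    intro x hx
    obtain ⟨y₀, hy₀⟩ := (hL' x).1 hx
    obtain ⟨hlen, hy₁⟩ := hshort x y₀ hy₀
    set y₁ := y₀.take (c * 2 ^ x.length + c) with hy₁def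
    refine ⟨boolPair y₁ (ones (2 ^ x.length)), ?_, ?_⟩
    · simp only [length_boolPair, List.length_replicate]
      have : y₁.length ≤ c * 2 ^ x.length + c := hlen
      nlinarith [Nat.one_le_two_pow (n := x.length)]
    · set z := boolPair x (boolPair y₁ (ones (2 ^ x.length))) with hz
      show g z ∈ U
      rw [hg_apply]
      have hrun := hV₂ z
      have e1 : fstF z = x := by simp [hz]
      have e2 : fstF (sndF z) = y₁ := by simp [hz]
      rw [e1, e2, hy₁, show encodeBool true = [true] from rfl] at hrun
      refine hcomplete z _ _ hrun ?_
      show p.eval _ ≤ (p.comp T).eval z.length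
      rw [eval_comp]
      apply TM2Iter.eval_mono
      have hzlen : z.length = 2 * x.length + 2 + (2 * y₁.length + 2 + 2 ^ x.length) := by
        simp [hz, length_boolPair]
      simp only [T, eval_add, eval_mul, eval_C, eval_X]
      nlinarith
  · -- soundness: the universal machine only accepts what `V₂` accepts
    intro x y hxy
    have hxy' : g (boolPair x y) ∈ U := hxy
    rw [hg_apply] at hxy'
    obtain ⟨t, ht⟩ := hsnd _ _ hxy'
    have h2 := hV₂ (boolPair x y)
    simp only [fstF_boolPair, sndF_boolPair] at h2
    have huniq : [true] = encodeBool (R' x (fstF y)) :=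
      List.map_injective_iff.2 V₂.outputAlphabet.symm.injective (TM2Std.outputs_unique V₂.tm ht h2)
    have hR' : R' x (fstF y) = true := by
      cases h : R' x (fstF y)
      · rw [h] at huniq
        exact absurd huniq (by decide)
      · rfl
    exact (hL' x).2 ⟨_, hR'⟩

/-- **Certificates for `NEXP`** (Arora–Barak 2009, §2.6.2: the exponential-certificate definition
of `NEXP`): for `L ∈ NEXP` there are `R ∈ P` and `k, c` such that every `x ∈ L` has a witness
`y` with `|y| ≤ c·2^{|x|ᵏ} + c` and `⟨x, y⟩ ∈ R`, and `⟨x, y⟩ ∈ R` forces `x ∈ L` for every `y`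
whatsoever. (Bring `L ∈ NTIME(2^{nᵏ})` to `padPre k L ∈ NTIME(2ⁿ)` by `padPre_mem_NTIME_two_pow`,
take the certificates there, and precompose the matrix with the polynomial pad `polyPad k`.)
[cite: AroraBarak2009, §2.6.2] -/
theorem exists_certificates_of_mem_NEXP {L : Language Bool} (hL : L ∈ NEXP) :
    ∃ R ∈ Classes.P, ∃ k c : ℕ,
      (∀ x ∈ L, ∃ y : List Bool, y.length ≤ c * 2 ^ (x.length ^ k) + c ∧ boolPair x y ∈ R) ∧
      (∀ x y : List Bool, boolPair x y ∈ R → x ∈ L) := by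
  simp only [NEXP, Set.mem_iUnion] at hL
  obtain ⟨k, hk⟩ := hL
  obtain ⟨R, hR, c, hcomp, hsnd⟩ :=
    exists_certificates_of_mem_NTIME_two_pow (padPre_mem_NTIME_two_pow hk)
  obtain ⟨K, b, -, hb⟩ := exists_two_pow_eval_le (2 * X + 2 + X ^ k)
  let g : List Bool → List Bool := fanoutFn (polyPad k ∘ fstF) sndF
  have hg_apply : ∀ x y, g (boolPair x y) = boolPair (polyPad k x) y := fun x y => by
    simp only [g]
    rw [fanoutFn_apply, Function.comp_apply, fstF_boolPair, sndF_boolPair]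
  refine ⟨(g ⁻¹' R : Language Bool), ?_, K, c * b + c, ?_, ?_⟩
  · exact preimage_mem_P hR
      (fanoutFn_mem_FP (comp_mem_FP (polyPad_mem_FP k) fstF_mem_FP) sndF_mem_FP)
  · intro x hx
    have hx' : polyPad k x ∈ padPre k L := by
      rw [mem_padPre, polyUnpad_polyPad]
      exact hx
    obtain ⟨y, hy, hyR⟩ := hcomp _ hx'
    refine ⟨y, ?_, ?_⟩
    · rw [length_polyPad] at hy
      have h1 := hb x.length
      simp only [eval_add, eval_mul, eval_ofNat, eval_X, eval_pow] at h1
      have h2 := Nat.mul_le_mul_left c h1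
      have h3 : c * b * 2 ^ (x.length ^ K) ≤ (c * b + c) * 2 ^ (x.length ^ K) :=
        Nat.mul_le_mul_right _ (by omega)
      calc y.length ≤ c * (b * 2 ^ (x.length ^ K)) + c := hy.trans (Nat.add_le_add_right h2 _)
        _ = c * b * 2 ^ (x.length ^ K) + c := by ring
        _ ≤ (c * b + c) * 2 ^ (x.length ^ K) + (c * b + c) := Nat.add_le_add h3 (by omega)
    · show g (boolPair x y) ∈ R
      rw [hg_apply]
      exact hyR
  · intro x y h
    have h' : g (boolPair x y) ∈ R := h
    rw [hg_apply] at h'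
    have := hsnd _ _ h'
    rwa [mem_padPre, polyUnpad_polyPad] at this

/-- **The certificate characterisation of `NEXP`.** [cite: AroraBarak2009, §2.6.2] -/
theorem mem_NEXP_iff_certificates {L : Language Bool} :
    L ∈ NEXP ↔ ∃ R ∈ Classes.P, ∃ k c : ℕ,
      (∀ x ∈ L, ∃ y : List Bool, y.length ≤ c * 2 ^ (x.length ^ k) + c ∧ boolPair x y ∈ R) ∧
      (∀ x y : List Bool, boolPair x y ∈ R → x ∈ L) :=
  ⟨exists_certificates_of_mem_NEXP, fun ⟨_, hR, k, c, hc, hs⟩ => mem_NEXP_of_certificates hR k c hc hs⟩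


/-! ### Closure under polynomial-time preimages, `∩`, `∪` -/

namespace NEXPCert

/-- `2^{nᵏ} ≤ 2 · 2^{n^K}` for `k ≤ K` (the factor `2` absorbs `0⁰ = 1`). [folklore] -/
theorem two_pow_pow_le_of_le {k K : ℕ} (h : k ≤ K) (n : ℕ) : 2 ^ (n ^ k) ≤ 2 * 2 ^ (n ^ K) := by
  rcases Nat.eq_zero_or_pos n with rfl | hn
  · have : 2 ^ (0 ^ k) ≤ 2 := by cases k <;> simp
    exact this.trans (by have := Nat.one_le_two_pow (n := 0 ^ K); omega)
  · have : 2 ^ (n ^ k) ≤ 2 ^ (n ^ K) := Nat.pow_le_pow_right Nat.two_pos (Nat.pow_le_pow_right hn h)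
    omega

end NEXPCert

/-- **`NEXP` is closed under polynomial-time preimages**: `f⁻¹(A) ∈ NEXP` for `A ∈ NEXP`, `f ∈ FP`
(the matrix `{⟨x, y⟩ | ⟨f x, y⟩ ∈ R}`; the witness bound `c·2^{|f x|ᵏ} + c` is again of the form
`c'·2^{|x|^K} + c'` because `|f x|` is polynomial). [cite: AroraBarak2009, §2.6.2 with Thm. 2.8] -/
theorem preimage_mem_NEXP_of_mem_FP {A : Language Bool} (hA : A ∈ NEXP) {f : List Bool → List Bool}
    (hf : f ∈ FP) : (f ⁻¹' A : Language Bool) ∈ NEXP := by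
  obtain ⟨R, hR, k, c, hcomp, hsnd⟩ := exists_certificates_of_mem_NEXP hA
  obtain ⟨s, hs⟩ := exists_poly_length_le_of_mem_FP hf
  obtain ⟨K, b, -, hb⟩ := exists_two_pow_eval_le (s ^ k)
  let g : List Bool → List Bool := fanoutFn (f ∘ fstF) sndF
  have hg_apply : ∀ x y, g (boolPair x y) = boolPair (f x) y := fun x y => by
    simp only [g]
    rw [fanoutFn_apply, Function.comp_apply, fstF_boolPair, sndF_boolPair]
  refine mem_NEXP_of_certificates (R := (g ⁻¹' R : Language Bool))
    (preimage_mem_P hR (fanoutFn_mem_FP (comp_mem_FP hf fstF_mem_FP) sndF_mem_FP)) K (c * b + c)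
    (fun x hx => ?_) (fun x y h => ?_)
  · obtain ⟨y, hy, hyR⟩ := hcomp (f x) hx
    refine ⟨y, ?_, ?_⟩
    · have h1 : 2 ^ ((f x).length ^ k) ≤ 2 ^ ((s.eval x.length) ^ k) :=
        Nat.pow_le_pow_right Nat.two_pos (Nat.pow_le_pow_left (hs x) k)
      have h2 := hb x.length
      rw [eval_pow] at h2
      have h3 := Nat.mul_le_mul_left c (h1.trans h2)
      have h4 : c * b * 2 ^ (x.length ^ K) ≤ (c * b + c) * 2 ^ (x.length ^ K) :=
        Nat.mul_le_mul_right _ (by omega)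
      calc y.length ≤ c * (b * 2 ^ (x.length ^ K)) + c := hy.trans (Nat.add_le_add_right h3 _)
        _ = c * b * 2 ^ (x.length ^ K) + c := by ring
        _ ≤ (c * b + c) * 2 ^ (x.length ^ K) + (c * b + c) := Nat.add_le_add h4 (by omega)
    · show g (boolPair x y) ∈ R
      rw [hg_apply]
      exact hyR
  · have h' : g (boolPair x y) ∈ R := h
    rw [hg_apply] at h'
    exact hsnd _ _ h'

/-- **`NEXP` is closed downward under Karp reductions.** [cite: AroraBarak2009, §2.6.2 with Thm. 2.8] -/
theorem mem_NEXP_of_karpReducible {L₁ L₂ : Language Bool} (h : L₁ ≤ₚ L₂) (h₂ : L₂ ∈ NEXP) :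
    L₁ ∈ NEXP := by
  obtain ⟨f, hf, hfL⟩ := h
  have hpre : L₁ = f ⁻¹' L₂ := Set.ext hfL
  rw [hpre]
  exact preimage_mem_NEXP_of_mem_FP h₂ hf

/-- `P ⊆ NEXP` (`P ⊆ NP ⊆ EXP ⊆ NEXP`). [cite: AroraBarak2009, §2.6.2] -/
theorem P_subset_NEXP : Classes.P ⊆ NEXP := fun _ hL =>
  EXP_subset_NEXP (NP_subset_EXP_holds (P_subset_NP_holds hL))

/-- **`NEXP` is closed under intersection** (pair the two certificates).
[cite: AroraBarak2009, §2.6.2 with Exercise 2.10] -/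
theorem inter_mem_NEXP {L₁ L₂ : Language Bool} (h₁ : L₁ ∈ NEXP) (h₂ : L₂ ∈ NEXP) :
    L₁ ⊓ L₂ ∈ NEXP := by
  obtain ⟨R₁, hR₁, k₁, c₁, hc₁, hs₁⟩ := exists_certificates_of_mem_NEXP h₁
  obtain ⟨R₂, hR₂, k₂, c₂, hc₂, hs₂⟩ := exists_certificates_of_mem_NEXP h₂
  let g₁ : List Bool → List Bool := fanoutFn fstF (fstF ∘ sndF)
  let g₂ : List Bool → List Bool := fanoutFn fstF (sndF ∘ sndF)
  have hg₁ : ∀ x y₁ y₂, g₁ (boolPair x (boolPair y₁ y₂)) = boolPair x y₁ := fun x y₁ y₂ => by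
    simp only [g₁]; rw [fanoutFn_apply]; simp
  have hg₂ : ∀ x y₁ y₂, g₂ (boolPair x (boolPair y₁ y₂)) = boolPair x y₂ := fun x y₁ y₂ => by
    simp only [g₂]; rw [fanoutFn_apply]; simp
  have hP : preimageL g₁ R₁ ⊓ preimageL g₂ R₂ ∈ Classes.P :=
    inter_mem_P (preimageL_mem_P hR₁ (fanoutFn_mem_FP fstF_mem_FP (comp_mem_FP fstF_mem_FP sndF_mem_FP)))
      (preimageL_mem_P hR₂ (fanoutFn_mem_FP fstF_mem_FP (comp_mem_FP sndF_mem_FP sndF_mem_FP)))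
  refine mem_NEXP_of_certificates hP (max k₁ k₂) (4 * c₁ + 2 * c₂ + 2) (fun x hx => ?_) (fun x y h => ?_)
  · obtain ⟨hx₁, hx₂⟩ := mem_inf_iff.1 hx
    obtain ⟨y₁, hy₁, hR₁y⟩ := hc₁ x hx₁
    obtain ⟨y₂, hy₂, hR₂y⟩ := hc₂ x hx₂
    refine ⟨boolPair y₁ y₂, ?_, ?_⟩
    · rw [length_boolPair]
      have e₁ := Nat.mul_le_mul_left c₁ (two_pow_pow_le_of_le (le_max_left k₁ k₂) x.length)
      have e₂ := Nat.mul_le_mul_left c₂ (two_pow_pow_le_of_le (le_max_right k₁ k₂) x.length)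
      set F := 2 ^ (x.length ^ max k₁ k₂)
      have e₃ : c₁ * (2 * F) = 2 * (c₁ * F) := by ring
      have e₄ : c₂ * (2 * F) = 2 * (c₂ * F) := by ring
      have e₅ : (4 * c₁ + 2 * c₂ + 2) * F = 4 * (c₁ * F) + 2 * (c₂ * F) + 2 * F := by ring
      rw [e₃] at e₁
      rw [e₄] at e₂
      rw [e₅]
      omega
    · rw [mem_inf_iff, mem_preimageL, mem_preimageL, hg₁, hg₂]
      exact ⟨hR₁y, hR₂y⟩
  · rw [mem_inf_iff, mem_preimageL, mem_preimageL] at h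
    have h₁' : g₁ (boolPair x y) = boolPair x (fstF y) := by
      simp only [g₁]; rw [fanoutFn_apply]; simp
    have h₂' : g₂ (boolPair x y) = boolPair x (sndF y) := by
      simp only [g₂]; rw [fanoutFn_apply]; simp
    rw [h₁', h₂'] at h
    exact mem_inf_iff.2 ⟨hs₁ _ _ h.1, hs₂ _ _ h.2⟩

/-- **`NEXP` is closed under union** (a certificate for either side, the other component arbitrary).
[cite: AroraBarak2009, §2.6.2 with Exercise 2.10] -/
theorem union_mem_NEXP {L₁ L₂ : Language Bool} (h₁ : L₁ ∈ NEXP) (h₂ : L₂ ∈ NEXP) :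
    L₁ ⊔ L₂ ∈ NEXP := by
  obtain ⟨R₁, hR₁, k₁, c₁, hc₁, hs₁⟩ := exists_certificates_of_mem_NEXP h₁
  obtain ⟨R₂, hR₂, k₂, c₂, hc₂, hs₂⟩ := exists_certificates_of_mem_NEXP h₂
  let g₁ : List Bool → List Bool := fanoutFn fstF (fstF ∘ sndF)
  let g₂ : List Bool → List Bool := fanoutFn fstF (sndF ∘ sndF)
  have hg₁ : ∀ x y, g₁ (boolPair x y) = boolPair x (fstF y) := fun x y => by
    simp only [g₁]; rw [fanoutFn_apply]; simp
  have hg₂ : ∀ x y, g₂ (boolPair x y) = boolPair x (sndF y) := fun x y => by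
    simp only [g₂]; rw [fanoutFn_apply]; simp
  have hP : preimageL g₁ R₁ ⊔ preimageL g₂ R₂ ∈ Classes.P :=
    union_mem_P (preimageL_mem_P hR₁ (fanoutFn_mem_FP fstF_mem_FP (comp_mem_FP fstF_mem_FP sndF_mem_FP)))
      (preimageL_mem_P hR₂ (fanoutFn_mem_FP fstF_mem_FP (comp_mem_FP sndF_mem_FP sndF_mem_FP)))
  refine mem_NEXP_of_certificates hP (max k₁ k₂) (4 * c₁ + 2 * c₂ + 2) (fun x hx => ?_) (fun x y h => ?_)
  · set F := 2 ^ (x.length ^ max k₁ k₂) with hF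
    have e₁ := Nat.mul_le_mul_left c₁ (two_pow_pow_le_of_le (le_max_left k₁ k₂) x.length)
    have e₂ := Nat.mul_le_mul_left c₂ (two_pow_pow_le_of_le (le_max_right k₁ k₂) x.length)
    rw [← hF] at e₁ e₂
    have e₃ : c₁ * (2 * F) = 2 * (c₁ * F) := by ring
    have e₄ : c₂ * (2 * F) = 2 * (c₂ * F) := by ring
    have e₅ : (4 * c₁ + 2 * c₂ + 2) * F = 4 * (c₁ * F) + 2 * (c₂ * F) + 2 * F := by ring
    rw [e₃] at e₁
    rw [e₄] at e₂
    rcases mem_sup_iff.1 hx with hx | hx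
    · obtain ⟨y₁, hy₁, hR₁y⟩ := hc₁ x hx
      refine ⟨boolPair y₁ [], ?_, ?_⟩
      · rw [length_boolPair, e₅]
        simp only [List.length_nil]
        omega
      · rw [mem_sup_iff, mem_preimageL, mem_preimageL, hg₁, fstF_boolPair]
        exact Or.inl hR₁y
    · obtain ⟨y₂, hy₂, hR₂y⟩ := hc₂ x hx
      refine ⟨boolPair [] y₂, ?_, ?_⟩
      · rw [length_boolPair, e₅]
        simp only [List.length_nil]
        omega
      · rw [mem_sup_iff, mem_preimageL, mem_preimageL, hg₂, sndF_boolPair]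
        exact Or.inr hR₂y
  · rw [mem_sup_iff, mem_preimageL, mem_preimageL, hg₁, hg₂] at h
    rcases h with h | h
    · exact mem_sup_iff.2 (Or.inl (hs₁ _ _ h))
    · exact mem_sup_iff.2 (Or.inr (hs₂ _ _ h))

/-! ### `∃ᵖ·NEXP ⊆ NEXP` -/

/-- **`NEXP` is closed under polynomially bounded existential quantification** (the short witness
`y` joins the long one: certificate `⟨y, Y⟩`, matrix "`|y| ≤ p(|x|)` and `⟨⟨x, y⟩, Y⟩ ∈ R`").
[cite: AroraBarak2009, §2.6.2 with Def. 2.1] -/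
theorem polyExists_NEXP_subset_NEXP : polyExists NEXP ⊆ NEXP := by
  rintro L ⟨L', hL', p, hp⟩
  obtain ⟨R, hR, k, c, hcomp, hsnd⟩ := exists_certificates_of_mem_NEXP hL'
  obtain ⟨K, b, hK1, hb⟩ := exists_two_pow_eval_le ((2 * X + 2 + p) ^ k)
  obtain ⟨b', hb'⟩ := TimeConstructible.exists_poly_le_two_pow_pow p hK1
  let g₁ : List Bool → List Bool := fanoutFn fstF (fstF ∘ sndF)
  let g₂ : List Bool → List Bool := fanoutFn (fanoutFn fstF (fstF ∘ sndF)) (sndF ∘ sndF)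
  have hg₁ : ∀ x w, g₁ (boolPair x w) = boolPair x (fstF w) := fun x w => by
    simp only [g₁]; rw [fanoutFn_apply]; simp
  have hg₂ : ∀ x w, g₂ (boolPair x w) = boolPair (boolPair x (fstF w)) (sndF w) := fun x w => by
    simp only [g₂]; rw [fanoutFn_apply, fanoutFn_apply]; simp
  have hg₁FP : g₁ ∈ FP := fanoutFn_mem_FP fstF_mem_FP (comp_mem_FP fstF_mem_FP sndF_mem_FP)
  have hg₂FP : g₂ ∈ FP := fanoutFn_mem_FP hg₁FP (comp_mem_FP sndF_mem_FP sndF_mem_FP)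
  have hP : preimageL g₁ (LenLe p) ⊓ preimageL g₂ R ∈ Classes.P :=
    inter_mem_P (preimageL_mem_P (LenLe_mem_P p) hg₁FP) (preimageL_mem_P hR hg₂FP)
  refine mem_NEXP_of_certificates hP K (2 * b' + c * b + (2 * b' + 2 + c))
    (fun x hx => ?_) (fun x w h => ?_)
  · obtain ⟨y, hy, hyL'⟩ := (hp x).1 hx
    obtain ⟨Y, hY, hYR⟩ := hcomp _ hyL'
    refine ⟨boolPair y Y, ?_, ?_⟩
    · set n := x.length with hn
      set F := 2 ^ (n ^ K) with hF
      have h1 : 2 ^ ((boolPair x y).length ^ k) ≤ b * F := by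
        refine le_trans (Nat.pow_le_pow_right Nat.two_pos (Nat.pow_le_pow_left (?_ :
          (boolPair x y).length ≤ 2 * n + 2 + p.eval n) k)) ?_
        · rw [length_boolPair]; omega
        · have := hb n
          simpa only [eval_pow, eval_add, eval_mul, eval_ofNat, eval_X] using this
      have h2 := Nat.mul_le_mul_left c h1
      have h3 := hb' n
      rw [← hF] at h3
      rw [length_boolPair]
      have e₁ : c * (b * F) = c * b * F := by ring
      have e₂ : (2 * b' + c * b + (2 * b' + 2 + c)) * F =
          2 * (b' * F) + c * b * F + (2 * b' + 2 + c) * F := by ring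
      rw [e₁] at h2
      rw [e₂]
      have h4 : 0 ≤ (2 * b' + 2 + c) * F := Nat.zero_le _
      omega
    · rw [mem_inf_iff, mem_preimageL, mem_preimageL, hg₁, hg₂, fstF_boolPair, sndF_boolPair,
        boolPair_mem_LenLe]
      exact ⟨hy, hYR⟩
  · rw [mem_inf_iff, mem_preimageL, mem_preimageL, hg₁, hg₂, boolPair_mem_LenLe] at h
    exact (hp x).2 ⟨fstF w, h.1, hsnd _ _ h.2⟩

/-! ### `∀ᵖ·NEXP ⊆ NEXP`: indexing the strings of length `≤ m` -/

namespace NEXPCert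

/-- The `i`-th binary string: the binary numeral of `i + 1` (least significant bit first,
`encodeNat`) without its leading `1`; a bijection `ℕ → {0,1}*` enumerating by length. [folklore] -/
def strN (i : ℕ) : List Bool := (encodeNat (i + 1)).dropLast

/-- The index of a string: `⟦y 1⟧₂ - 1`. [folklore] -/
def idxN (y : List Bool) : ℕ := bitsToNat (y ++ [true]) - 1

/-- A numeral ending in `1` is canonical: `encodeNat ⟦y 1⟧₂ = y 1`. [folklore] -/
theorem encodeNat_bitsToNat_append_true (y : List Bool) :
    encodeNat (bitsToNat (y ++ [true])) = y ++ [true] := by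
  have h1 : canonF (y ++ [true]) = y ++ [true] := by
    rw [canonF_apply, if_neg]
    simp
  have h2 := bitsToNat_canonF (y ++ [true])
  rw [h1] at h2
  rw [h2, ← canonF_eq_encodeNat_decodeNat, h1]

/-- `strN (idxN y) = y`. [folklore] -/
theorem strN_idxN (y : List Bool) : strN (idxN y) = y := by
  have h1 : 1 ≤ bitsToNat (y ++ [true]) := by
    rw [bitsToNat_append]; have := Nat.one_le_two_pow (n := y.length); simp; omega
  rw [strN, idxN, Nat.sub_add_cancel h1, encodeNat_bitsToNat_append_true, List.dropLast_concat]

/-- `idxN y < 2^{|y|+1}` (indeed `idxN y + 1 < 2^{|y|+1}`). [folklore] -/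
theorem idxN_lt (y : List Bool) : idxN y + 1 < 2 ^ (y.length + 1) := by
  have h1 : 1 ≤ bitsToNat (y ++ [true]) := by
    rw [bitsToNat_append]; have := Nat.one_le_two_pow (n := y.length); simp; omega
  have h2 := bitsToNat_lt (y ++ [true])
  simp only [List.length_append, List.length_singleton] at h2
  rw [idxN, Nat.sub_add_cancel h1]
  exact h2

/-- Long indices name long strings: `2^K ≤ i + 1 → K ≤ |strN i|`. [folklore] -/
theorem le_length_strN {K i : ℕ} (h : 2 ^ K ≤ i + 1) : K ≤ (strN i).length := by
  rw [strN, List.length_dropLast]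
  have h1 := bitsToNat_lt (encodeNat (i + 1))
  rw [bitsToNat_encodeNat] at h1
  have h2 : K < (encodeNat (i + 1)).length := by
    by_contra h3
    push Not at h3
    have := Nat.pow_le_pow_right Nat.two_pos h3
    omega
  omega

/-- The `boolPair`-coded list of `m` entries has length `≥ 2m`. [folklore] -/
theorem two_mul_length_le_length_body (cs : List (List Bool)) :
    2 * cs.length ≤ (OracleCompose.body cs).length := by
  induction cs with
  | nil => simp
  | cons a cs ih =>
    rw [OracleCompose.body_cons, length_boolPair, List.length_cons]
    omega

/-- `strN` as a brick on the unary index: `u ↦ strN |u|` — numeral of `|u| + 1` (`lenBinF`, `addFn`)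
with its last symbol dropped (`takeFn` with the tail as ruler). [folklore] -/
noncomputable def strFn : List Bool → List Bool :=
  takeFn ∘ fanoutFn List.tail id ∘ addFn ∘ fanoutFn lenBinF (fun _ => [true])

/-- `strFn ∈ FP`. [folklore] -/
theorem strFn_mem_FP : strFn ∈ FP :=
  comp_mem_FP takeFn_mem_FP (comp_mem_FP (fanoutFn_mem_FP PRelSigma.tail_mem_FP OracleCompose.id_mem_FP)
    (comp_mem_FP addFn_mem_FP (fanoutFn_mem_FP lenBinF_mem_FP (const_mem_FP _))))

/-- Value of `strFn`. [folklore] -/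
@[simp] theorem strFn_apply (u : List Bool) : strFn u = strN u.length := by
  have h2 : bitsToNat [true] = 1 := by simp
  unfold strFn strN
  simp only [Function.comp_apply, fanoutFn_apply, lenBinF_apply, addFn_boolPair, bitsToNat_encodeNat, h2,
    takeFn_boolPair, id_eq, List.length_tail, List.dropLast_eq_take]

end NEXPCert

/-- **`NEXP` is closed under polynomially bounded universal quantification** ("the inclusion
`(∀ poly(n)) NEXP ⊆ NEXP` follows from concatenating the witnesses for every possibility in the
universal quantifier", Chen–Jin–Santhanam–Williams 2022, proof of Cor. 5.3; Arora–Barak 2009,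
§2.6.2). For `x ∈ L ↔ ∀ y, |y| ≤ p(|x|) → ⟨x, y⟩ ∈ L'` with `L' ∈ NEXP`: the certificate is the
`boolPair`-coded list `Z` of `2^{p(|x|)+1}` certificates, the `i`-th for the `i`-th string
`strN i` (all strings of length `≤ p(|x|)` occur); the matrix is the polynomially bounded loop
`ballLang X` (`TruthTableClosure.lean`) over the indices `i < |⟨x, Z⟩|` of "`|strN i| > p(|x|)`, or
the `i`-th entry of `Z` certifies `⟨x, strN i⟩`", guarded by `2^{p(|x|)+1} ≤ |⟨x, Z⟩|` (tested
through `logFn`). [cite: ChenEtAl2022, §5.1 (proof of Cor. 5.3)] [cite: AroraBarak2009, §2.6.2] -/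
theorem polyForall_NEXP_subset_NEXP : polyForall NEXP ⊆ NEXP := by
  classical
  intro L hL
  obtain ⟨L', hL', p, hp⟩ := mem_polyForall_iff.1 hL
  obtain ⟨R, hR, k, c, hcomp, hsnd⟩ := exists_certificates_of_mem_NEXP hL'
  -- the bricks of the matrix, on `⟨⟨x, Z⟩, u⟩`
  let h₁ : List Bool → List Bool := fanoutFn (fstF ∘ fstF) (strFn ∘ sndF)
  let h₂ : List Bool → List Bool := fanoutFn h₁ (PRelSigPi.elemFn ∘ fanoutFn sndF (sndF ∘ fstF))
  let h₃ : List Bool → List Bool := fanoutFn fstF logFn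
  have hh₁ : ∀ x Z u, h₁ (boolPair (boolPair x Z) u) = boolPair x (strN u.length) := fun x Z u => by
    simp only [h₁]; rw [fanoutFn_apply]; simp
  have hh₂ : ∀ x Z u, h₂ (boolPair (boolPair x Z) u) =
      boolPair (boolPair x (strN u.length)) (PRelSigPi.elemOf Z u.length) := fun x Z u => by
    simp only [h₂]; rw [fanoutFn_apply, hh₁]; simp [fanoutFn_apply, PRelSigPi.elemFn_boolPair]
  have hh₃ : ∀ x Z, h₃ (boolPair x Z) = boolPair x (logFn (boolPair x Z)) := fun x Z => by
    simp only [h₃]; rw [fanoutFn_apply]; simp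
  have hh₁FP : h₁ ∈ FP :=
    fanoutFn_mem_FP (comp_mem_FP fstF_mem_FP fstF_mem_FP) (comp_mem_FP strFn_mem_FP sndF_mem_FP)
  have hh₂FP : h₂ ∈ FP := fanoutFn_mem_FP hh₁FP
    (comp_mem_FP PRelSigPi.elemFn_mem_FP (fanoutFn_mem_FP sndF_mem_FP (comp_mem_FP sndF_mem_FP fstF_mem_FP)))
  have hh₃FP : h₃ ∈ FP := fanoutFn_mem_FP fstF_mem_FP logFn_mem_FP
  -- the matrix: guard `p(|x|) + 1 ≤ log₂ |⟨x, Z⟩|`, and the loop over indices `i < |⟨x, Z⟩|`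
  let A : Language Bool := (preimageL h₁ (LenLe p))ᶜ ⊔ preimageL h₂ R
  let Rm : Language Bool := (preimageL h₃ (LenLt (p + 1)))ᶜ ⊓ ballLang X A
  have hA : A ∈ Classes.P :=
    union_mem_P (compl_mem_P_iff.2 (preimageL_mem_P (LenLe_mem_P p) hh₁FP)) (preimageL_mem_P hR hh₂FP)
  have hRm : Rm ∈ Classes.P :=
    inter_mem_P (compl_mem_P_iff.2 (preimageL_mem_P (LenLt_mem_P _) hh₃FP)) (ballLang_mem_P X hA)
  have memA : ∀ x Z u, boolPair (boolPair x Z) u ∈ A ↔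
      ((strN u.length).length ≤ p.eval x.length →
        boolPair (boolPair x (strN u.length)) (PRelSigPi.elemOf Z u.length) ∈ R) := fun x Z u => by
    rw [mem_sup_iff, mem_compl_iff, mem_preimageL, mem_preimageL, hh₁, hh₂, boolPair_mem_LenLe,
      imp_iff_not_or]
  have memRm : ∀ x Z, boolPair x Z ∈ Rm ↔
      (p.eval x.length + 1 ≤ Nat.log 2 (boolPair x Z).length ∧
        ∀ i < (boolPair x Z).length, boolPair (boolPair x Z) (List.replicate i true) ∈ A) := fun x Z => by
    rw [mem_inf_iff, mem_compl_iff, mem_preimageL, hh₃, boolPair_mem_LenLt, length_logFn, mem_ballLang,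
      eval_X, not_lt, eval_add, eval_one]
  have hlog : ∀ x Z : List Bool, ∀ m : ℕ, m ≤ Nat.log 2 (boolPair x Z).length ↔ 2 ^ m ≤ (boolPair x Z).length :=
    fun x Z m => Nat.le_log_iff_pow_le Nat.one_lt_two (by rw [length_boolPair]; omega)
  -- exponent bookkeeping
  obtain ⟨K, b, -, hb⟩ := exists_two_pow_eval_le (p + 1 + (2 * X + 2 + p) ^ k)
  refine mem_NEXP_of_certificates hRm K ((4 * c + 2) * b) (fun x hx => ?_) (fun x Z h => ?_)
  · -- completeness: the list of all certificates
    set M : ℕ := 2 ^ (p.eval x.length + 1) with hM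
    have hall : ∀ y : List Bool, y.length ≤ p.eval x.length → boolPair x y ∈ L' := (hp x).1 hx
    set Wmax : ℕ := c * 2 ^ ((2 * x.length + 2 + p.eval x.length) ^ k) + c with hWmax
    have hW : ∀ i : ℕ, ∃ w : List Bool, w.length ≤ Wmax ∧ ((strN i).length ≤ p.eval x.length →
        boolPair (boolPair x (strN i)) w ∈ R) := fun i => by
      by_cases hi : (strN i).length ≤ p.eval x.length
      · obtain ⟨w, hw, hwR⟩ := hcomp _ (hall _ hi)
        refine ⟨w, hw.trans ?_, fun _ => hwR⟩
        have : (boolPair x (strN i)).length ≤ 2 * x.length + 2 + p.eval x.length := by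
          rw [length_boolPair]; omega
        exact Nat.add_le_add_right (Nat.mul_le_mul_left c
          (Nat.pow_le_pow_right Nat.two_pos (Nat.pow_le_pow_left this k))) c
      · exact ⟨[], Nat.zero_le _, fun h => absurd h hi⟩
    choose W hWlen hWR using hW
    set cs : List (List Bool) := List.ofFn fun i : Fin M => W i with hcs
    have hcslen : cs.length = M := by simp [hcs]
    have hcsget : ∀ i, i < M → cs.getD i [] = W i := fun i hi => by
      rw [List.getD_eq_getElem _ _ (by rw [hcslen]; exact hi)]
      simp [hcs]
    refine ⟨OracleCompose.body cs, ?_, ?_⟩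
    · -- length of the certificate
      have hb1 := PRelSigPi.length_body_le (cs := cs) (b := Wmax) (fun w hw => by
        rw [hcs, List.mem_ofFn] at hw
        obtain ⟨i, rfl⟩ := hw
        exact hWlen i)
      rw [hcslen] at hb1
      have hb2 := hb x.length
      simp only [eval_add, eval_one, eval_pow, eval_mul, eval_ofNat, eval_X] at hb2
      rw [pow_add, ← hM] at hb2
      set Q := 2 ^ ((2 * x.length + 2 + p.eval x.length) ^ k) with hQ
      have hQ1 : 1 ≤ Q := Nat.one_le_two_pow
      have h3 : 2 * Wmax + 2 ≤ (4 * c + 2) * Q := by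
        simp only [hWmax]
        nlinarith
      calc (OracleCompose.body cs).length ≤ M * (2 * Wmax + 2) := hb1
        _ ≤ M * ((4 * c + 2) * Q) := Nat.mul_le_mul_left _ h3
        _ = (4 * c + 2) * (M * Q) := by ring
        _ ≤ (4 * c + 2) * (b * 2 ^ (x.length ^ K)) := Nat.mul_le_mul_left _ hb2
        _ = (4 * c + 2) * b * 2 ^ (x.length ^ K) := by ring
        _ ≤ (4 * c + 2) * b * 2 ^ (x.length ^ K) + (4 * c + 2) * b := Nat.le_add_right _ _
    · -- membership in the matrix
      rw [memRm]
      constructor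
      · rw [hlog, length_boolPair]
        have := two_mul_length_le_length_body cs
        rw [hcslen] at this
        omega
      · intro i hi
        rw [memA, List.length_replicate]
        intro hlen
        have hiM : i < M := by
          by_contra hge
          push Not at hge
          have := le_length_strN (K := p.eval x.length + 1) (i := i) (by rw [← hM]; omega)
          omega
        rw [PRelSigPi.elemOf_body, hcsget i hiM]
        exact hWR i hlen
  · -- soundness
    obtain ⟨hguard, hball⟩ := (memRm x Z).1 h
    rw [hlog] at hguard
    refine (hp x).2 fun y hy => ?_
    have hi : idxN y < (boolPair x Z).length := by
      have h1 := idxN_lt y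
      have h2 : 2 ^ (y.length + 1) ≤ 2 ^ (p.eval x.length + 1) :=
        Nat.pow_le_pow_right Nat.two_pos (by omega)
      omega
    have hA' := (memA x Z (List.replicate (idxN y) true)).1 (hball _ hi)
    rw [List.length_replicate, strN_idxN] at hA'
    exact hsnd _ _ (hA' hy)

end Literature.Computability.Complexity
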